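import Literature.Computability.Complexity.Classes
import Literature.Computability.Complexity.Nondeterministic
import Literature.Barriers.PneNP.RelativizationSparse
import HarnessLib

/-!
# Sparse and tally sets in `NP − P`: upward separation (Book 1974; Hartmanis–Immerman–Sewelson 1985)

Topic `Literature/Computability/Complexity`; problem `PneNP`. Named facts (statements as printed, no
proofs) for the classical "upward separation / tally translation" theorems that several `PneNP` route
theses invoke as the calibration of their tally- or sparse-set hypotheses:

* route `RamseyAliens` (`Summit.PneNP.PneNP.Theses.RamseyAliens.RamseyNotP`, `stmt-PneNP-2273`, and
  the target `NoExtremalPrinter`, `stmt-PneNP-2270`): the unary Ramsey language is a sparse `Σ₂ᵖ` set,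
  so its non-membership in `P` is a statement "of `Σ₂E ≠ E` strength" — the genre of Theorem 1 below;
* route `DelsarteLasserre` (`NexpSubsetExpOfNpSubsetP`, `stmt-PneNP-2131`, and its `Assembly`), route
  `TwoTones`, and `QuantumAdvantage/PadKuperberg`, which cite `Book1974` /
  `HartmanisImmermanSewelson1985` for the padding direction.

The EASY (padding) directions are provable with tree infrastructure already in place
(`Literature/Computability/MetaComplexity/AvgCaseTallyNE.lean`: the tally code `tnum`,
`tallyDecodeFn_mem_FP`, `tallyPadFn`, "`T(L) ∈ NP` for `L ∈ NTIME(2^{an})`"; padding lemmas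
`padPre_mem_NTIME_two_pow`, `exists_pad_mem_NP`, `preimage_mem_E`, `lpad_mem_FE` used by
`DelsarteLasserre`); the HARD direction of Theorem 1 of [HIS85] (`E = NE ⇒` every sparse `NP` set is in
`P`, by the census/naming encoding `S' = {n#i#j#k#d | …}` of p. 163–165) is not in the tree, which is
why these are vendored as named facts (users take `(h : hartmanisImmermanSewelson1985_thm1)`).

Vocabulary (all tree notions, `lean search`ed 2026-08-15): `Classes.P`, `Nondeterministic.NP`,
`E = ⋃_c DTIME(2^{cn})` (`Classes.lean`), `NE = ⋃_c NTIME(2^{cn})` (`Nondeterministic.lean`) — these are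
exactly [HIS85]'s `EXPTIME := ⋃_{c>0} TIME[2^{cn}]` and `NEXPTIME := ⋃_{c>0} NTIME[2^{cn}]` (p. 162:
"the location of the constant in the exponent is required by the upward separation method"; the
tree's unions also admit `c = 0`, which adds nothing); sparse = the tree's
`Literature.Barriers.PneNP.IsSparseLanguage` (`|L ∩ {0,1}ⁿ| ≤ n^c + c` for all `n`; [HIS85] p. 162
counts the words of length `≤ n`, `|S ∩ (ε+Σ)ⁿ| ≤ n^k + k` — the two notions coincide up to the choice
of the constant, since `Σ_{m≤n} (m^c + c) ≤ (n+1)^{c+1} + (n+1)c`); tally = the tree's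
`Literature.Barriers.PneNP.IsTally` (`T ⊆ 0*`; [Book74]/[HIS85] write tally sets over the letter `1`,
`TALLY(A) = {1ⁿ | 1n ∈ A}` — immaterial: the letter swap is a length-preserving polynomial-time
bijection of `{0,1}*` preserving membership in `P` and `NP`). The linear-exponential classes `E`, `NE`
and the classes `P`, `NP` are robust under the polynomial overheads between the papers' multitape
machines and the tree's Mathlib `TM2` model (`2^{cn}` steps become `2^{c'n}`), so the statements are
model-faithful.

## References

* R. V. Book, *Tally languages and complexity classes*, Information and Control 26 (1974) 186–193,
  Theorem 1 (p. 189) (held: `paper:doi-10-1016-s0019-9958-74-90473-2`, p0004). [Book1974]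
* J. Hartmanis, N. Immerman, V. Sewelson, *Sparse sets in NP−P: EXPTIME versus NEXPTIME*, Information
  and Control 65 (1985) 158–181, Theorem 1 (p. 163), Corollary 4 (p. 166), definitions p. 162 (held:
  `paper:doi-10-1016-s0019-9958-85-80004-8`, p0005–p0006, p0009). [HartmanisImmermanSewelson1985]
-/

namespace Literature.Computability.Complexity

open Literature.Barriers.PneNP (IsSparseLanguage IsTally)

/-- **Book 1974, Theorem 1, (i) ⇔ (ii)** (Information and Control 26, p. 189, verbatim): "The following
are equivalent: (i) Every language accepted by a nondeterministic Turing machine which operates within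
time bound `2^{cn}` for some `c > 0` is also accepted by a deterministic Turing machine which operates
within time bound `2^{dn}` for some `d > 0`. (ii) Every tally language which is accepted by a
nondeterministic polynomial time bounded Turing machine is also accepted by a deterministic polynomial
time bounded Turing machine." In the tree's classes: `NE ⊆ E` iff every tally language in `NP` is in
`P` (tally = `IsTally`, a subset of `0*`; Book's one-letter alphabet is `{1}`, see the module docstring
for why the letter is immaterial). Calibrates the tally hypotheses of `Summit.PneNP.PneNP.Theses.RamseyAliens.RamseyNotP`
(`stmt-PneNP-2273`) and is the source cited by `Summit.PneNP.PneNP.Theses.DelsarteLasserre.NexpSubsetExpOfNpSubsetP`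
(`stmt-PneNP-2131`). [cite: Book1974, Theorem 1 (p. 189), (i) ⇔ (ii)] -/
def book1974_thm1 : Prop :=
  NE ⊆ E ↔
    ∀ L : Language Bool, IsTally L → L ∈ Nondeterministic.NP → L ∈ Classes.P

/-- **Hartmanis–Immerman–Sewelson 1985, Theorem 1** (Information and Control 65, p. 163, verbatim):
"There exists a sparse set `S` in `NP − P` if and only if `EXPTIME ≠ NEXPTIME`", where (p. 162)
`EXPTIME = ⋃_{c>0} TIME[2^{cn}]` and `NEXPTIME = ⋃_{c>0} NTIME[2^{cn}]` are the LINEAR-exponential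
classes, i.e. the tree's `E` and `NE`, and (p. 162) "`S` is sparse iff `|S ∩ (ε+Σ)ⁿ| ≤ n^k + k`" (the
tree's `IsSparseLanguage`, same notion up to the constant). The `⇐` direction is Book's tally
translation (`TALLY(A) = {1ⁿ | 1n ∈ A} ∈ NP − P` for `A ∈ NEXPTIME − EXPTIME`, p. 163); the `⇒`
direction ("if `EXPTIME = NEXPTIME` then every sparse `NP` set is in `P`") is the paper's upward
separation method (pp. 163–165). Grounds the strength calibration of
`Summit.PneNP.PneNP.Theses.RamseyAliens.RamseyNotP` (`stmt-PneNP-2273`: a sparse — indeed tally-like —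
set in `Σ₂ᵖ − P`; p. 161 of the paper poses the `PH` analogue as open and exhibits an oracle with
`E^A = NE^A` but sparse sets in `Σ₂ᵖ,ᴬ − P^A`) and of `Summit.PneNP.PneNP.Theses.RamseyAliens.NoExtremalPrinter`
(`stmt-PneNP-2270`). [cite: HartmanisImmermanSewelson1985, Theorem 1 (p. 163); definitions p. 162] -/
def hartmanisImmermanSewelson1985_thm1 : Prop :=
  (∃ S : Language Bool, IsSparseLanguage S ∧ S ∈ Nondeterministic.NP ∧ S ∉ Classes.P) ↔ E ≠ NE

/-- **Hartmanis–Immerman–Sewelson 1985, Corollary 4** (Information and Control 65, p. 166, verbatim):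
"There exist sparse sets in `NP − P` if and only if there exist tally sets in `NP − P`." (Both are
equivalent to `EXPTIME ≠ NEXPTIME` by Theorem 1 and Book 1974.) Sparse = `IsSparseLanguage`,
tally = `IsTally` (see the module docstring). [cite: HartmanisImmermanSewelson1985, Corollary 4 (p. 166)] -/
def hartmanisImmermanSewelson1985_cor4 : Prop :=
  (∃ S : Language Bool, IsSparseLanguage S ∧ S ∈ Nondeterministic.NP ∧ S ∉ Classes.P) ↔
    ∃ T : Language Bool, IsTally T ∧ T ∈ Nondeterministic.NP ∧ T ∉ Classes.P

end Literature.Computability.Complexity
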